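import Mathlib
import HarnessLib
import Literature.Analysis.Fourier.LowPassKernel

/-!
# The locally constant inequality for exponential sums with frequencies in a ball (PROVED)

Topic `Literature/Analysis/Fourier` (support for discrete restriction / decoupling arguments, e.g.
the weights `w_N` of J. Bourgain, *Decoupling, exponential sums and the Riemann zeta function*,
J. Amer. Math. Soc. 30 (2017), remark after (1.2): "`L⁶_#(B_N)` … should be some weighted space
`L⁶_#(w_N)` with weight `1_{B_N} ≲ w_N(x) ≤ (1 + |x|/N)^{-10d}`"). For a finite exponential sum
`F(x) = ∑_{n ∈ S} a_n e(⟨ξ_n, x⟩)` on a Euclidean space `E` (`e(t) = exp(2πit)`) whose frequencies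
lie in a ball `‖ξ_n - ξ₀‖ ≤ κ/4`, and the tree's Schwartz low-pass kernel `g_κ`
(`Literature/Analysis/Fourier/LowPassKernel.lean`: `𝓕 g_κ = 1` on `‖ξ‖ ≤ κ/4`):

* `expSum_eq_integral` — the **reproducing formula** `F(x) = ∫ F(x - y) g_κ(y) e(⟨ξ₀, y⟩) dy`
  (finite sums and `𝓕 g_κ (ξ_n - ξ₀) = 1`; no Fourier inversion);
* `norm_expSum_le_integral` — `|F(x)| ≤ ∫ |F(x - y)| |g_κ(y)| dy`;
* `norm_expSum_rpow_le_integral` — for `p ≥ 1`, `|F(x)|^p ≤ m^{p-1} ∫ |F(x - y)|^p |g_κ(y)| dy`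
  with `m = ∫ |g_κ| = lowPassMass E` independent of `κ` (Jensen for the probability measure
  `|g_κ| dy / m`, Mathlib's `ConvexOn.map_average_le`);
* `abs_lowPassKernel_le` — Schwartz decay of the dilates: `|g_κ(y)| ≤ C_M κ^d (1 + κ‖y‖)^{-M}`;
* `norm_expSum_rpow_le_integral_weight` — hence, for `M > d = dim E`,
  `|F(x)|^p ≤ m^{p-1} C_M κ^d ∫ |F(x - y)|^p (1 + κ‖y‖)^{-M} dy`: `|F|^p` is dominated by its
  average against an `L¹`-normalised polynomially decaying weight at scale `1/κ`, and
  `norm_expSum_rpow_le_integral_weight_of_norm_sub_le` — the same average at `x` controls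
  `|F(x')|^p` for all `‖x' - x‖ ≤ 1/κ` ("`F` is essentially constant on balls of radius `1/κ`";
  translation and Peetre's inequality).

Everything here is PROVED (Mathlib + the tree); no definition and no named fact is introduced.

## References

* J. Bourgain, *Decoupling, exponential sums and the Riemann zeta function*, J. Amer. Math. Soc.
  30 (2017), 205–224 — remark after (1.2) on the weights `w_N`. [BourgainJAMS2017]
* J. Bourgain, C. Demeter, *The proof of the `ℓ²` decoupling conjecture*, Ann. of Math. 182 (2015),
  351–389 — §4 (weights and locally constant heuristics), for orientation.
-/

noncomputable section

open MeasureTheory Real Complex Finset Filter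
open scoped FourierTransform RealInnerProductSpace

namespace Literature.Analysis.Fourier
namespace ExpSumLocallyConstant

variable {E : Type*} [NormedAddCommGroup E] [InnerProductSpace ℝ E] [FiniteDimensional ℝ E]
  [MeasurableSpace E] [BorelSpace E] {ι : Type*}

/-! ### The low-pass kernel reproduces exponential sums with frequencies in a small ball -/

/-- The modulated kernel integral is the Fourier integral of `g_κ`:
`∫ g_κ(y) e(-⟨y, w⟩) dy = 𝓕 g_κ (w)`. [folklore] -/
theorem integral_lowPassKernel_mul_cexp {κ : ℝ} (w : E) :
    ∫ y, ((lowPassKernel E κ y : ℝ) : ℂ) * Complex.exp (2 * π * I * ((-⟪y, w⟫ : ℝ) : ℂ)) =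
      𝓕 (fun y => ((lowPassKernel E κ y : ℝ) : ℂ)) w := by
  rw [Real.fourier_eq]
  refine integral_congr_ae (Eventually.of_forall fun y => ?_)
  simp only [Circle.smul_def, smul_eq_mul, Real.fourierChar_apply]
  rw [mul_comm]
  congr 1
  congr 1
  push_cast
  ring

/-- Hence `∫ g_κ(y) e(-⟨y, w⟩) dy = 1` for `‖w‖ ≤ κ/4`. [folklore] -/
theorem integral_lowPassKernel_mul_cexp_eq_one {κ : ℝ} (hκ : 0 < κ) {w : E}
    (hw : ‖w‖ ≤ κ / 4) :
    ∫ y, ((lowPassKernel E κ y : ℝ) : ℂ) * Complex.exp (2 * π * I * ((-⟪y, w⟫ : ℝ) : ℂ)) = 1 := by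
  rw [integral_lowPassKernel_mul_cexp, fourierIntegral_ofReal_lowPassKernel_of_norm_le hκ hw]

/-- Integrability of the modulated kernel `g_κ(y) e(-⟨y, w⟩)`. [folklore] -/
theorem integrable_lowPassKernel_mul_cexp {κ : ℝ} (hκ : 0 < κ) (w : E) :
    Integrable (fun y : E => ((lowPassKernel E κ y : ℝ) : ℂ) *
      Complex.exp (2 * π * I * ((-⟪y, w⟫ : ℝ) : ℂ))) := by
  have h1 : Integrable (fun y : E => Complex.exp (2 * π * I * ((-⟪y, w⟫ : ℝ) : ℂ)) *
      ((lowPassKernel E κ y : ℝ) : ℂ)) := by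
    have hn1 : ∀ r : ℝ, ‖Complex.exp (2 * π * I * (r : ℂ))‖ = 1 := fun r => by
      rw [show (2 * π * I * (r : ℂ)) = ((2 * π * r : ℝ) : ℂ) * I by push_cast; ring]
      exact Complex.norm_exp_ofReal_mul_I _
    refine Integrable.bdd_mul (c := 1) (integrable_lowPassKernel hκ).ofReal ?_ ?_
    · exact (Continuous.aestronglyMeasurable (by fun_prop))
    · exact Eventually.of_forall fun y => (hn1 _).le
  simpa only [mul_comm] using h1

/-- **Reproducing formula.** If all frequencies `ξ_n` lie in the ball `‖ξ - ξ₀‖ ≤ κ/4`, then the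
exponential sum `F(x) = ∑ a_n e(⟨ξ_n, x⟩)` satisfies `F = F ∗ (g_κ e(⟨ξ₀, ·⟩))` pointwise:
`F(x) = ∫ F(x - y) g_κ(y) e(⟨ξ₀, y⟩) dy` (`𝓕 g_κ = 1` on the ball, no Fourier inversion is
needed). [folklore] -/
theorem expSum_eq_integral {κ : ℝ} (hκ : 0 < κ) (S : Finset ι) (a : ι → ℂ) (ξ : ι → E)
    (ξ₀ : E) (hξ : ∀ n ∈ S, ‖ξ n - ξ₀‖ ≤ κ / 4) (x : E) :
    ∑ n ∈ S, a n * Complex.exp (2 * π * I * (⟪ξ n, x⟫ : ℂ)) =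
      ∫ y, (∑ n ∈ S, a n * Complex.exp (2 * π * I * (⟪ξ n, x - y⟫ : ℂ))) *
        (((lowPassKernel E κ y : ℝ) : ℂ) * Complex.exp (2 * π * I * (⟪ξ₀, y⟫ : ℂ))) := by
  have hterm : ∀ y : E, (∑ n ∈ S, a n * Complex.exp (2 * π * I * (⟪ξ n, x - y⟫ : ℂ))) *
      (((lowPassKernel E κ y : ℝ) : ℂ) * Complex.exp (2 * π * I * (⟪ξ₀, y⟫ : ℂ))) =
      ∑ n ∈ S, (a n * Complex.exp (2 * π * I * (⟪ξ n, x⟫ : ℂ))) *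
        (((lowPassKernel E κ y : ℝ) : ℂ) *
          Complex.exp (2 * π * I * ((-⟪y, ξ n - ξ₀⟫ : ℝ) : ℂ))) := by
    intro y
    rw [Finset.sum_mul]
    refine Finset.sum_congr rfl fun n _ => ?_
    have e : ⟪ξ n, x - y⟫ + ⟪ξ₀, y⟫ = ⟪ξ n, x⟫ + -⟪y, ξ n - ξ₀⟫ := by
      rw [inner_sub_right, inner_sub_right, real_inner_comm y (ξ n), real_inner_comm y ξ₀]
      ring
    calc a n * Complex.exp (2 * π * I * (⟪ξ n, x - y⟫ : ℂ)) *
          (((lowPassKernel E κ y : ℝ) : ℂ) * Complex.exp (2 * π * I * (⟪ξ₀, y⟫ : ℂ)))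
        = a n * ((lowPassKernel E κ y : ℝ) : ℂ) *
            (Complex.exp (2 * π * I * (⟪ξ n, x - y⟫ : ℂ)) *
              Complex.exp (2 * π * I * (⟪ξ₀, y⟫ : ℂ))) := by ring
      _ = a n * ((lowPassKernel E κ y : ℝ) : ℂ) *
            (Complex.exp (2 * π * I * (⟪ξ n, x⟫ : ℂ)) *
              Complex.exp (2 * π * I * ((-⟪y, ξ n - ξ₀⟫ : ℝ) : ℂ))) := by
          rw [← Complex.exp_add, ← Complex.exp_add]
          congr 1
          have e' : (2 * π * I * (⟪ξ n, x - y⟫ : ℂ) + 2 * π * I * (⟪ξ₀, y⟫ : ℂ) : ℂ) =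
              2 * π * I * ((⟪ξ n, x - y⟫ + ⟪ξ₀, y⟫ : ℝ) : ℂ) := by push_cast; ring
          rw [e', e]
          push_cast
          ring
      _ = _ := by ring
  simp_rw [hterm]
  rw [integral_finsetSum _ (fun n hn => ?_)]
  · refine Finset.sum_congr rfl fun n hn => ?_
    rw [MeasureTheory.integral_const_mul, integral_lowPassKernel_mul_cexp_eq_one hκ (hξ n hn),
      mul_one]
  · exact (integrable_lowPassKernel_mul_cexp hκ _).const_mul _

/-- **The locally constant inequality (pointwise form).** With the hypotheses of
`expSum_eq_integral`: `|F(x)| ≤ ∫ |F(x - y)| |g_κ(y)| dy`, where `∫ |g_κ| = lowPassMass E` does not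
depend on `κ` and `g_κ` decays like `κ^d (1 + κ‖y‖)^{-M}` for every `M`
(`abs_lowPassKernel_le`). [folklore] -/
theorem norm_expSum_le_integral {κ : ℝ} (hκ : 0 < κ) (S : Finset ι) (a : ι → ℂ) (ξ : ι → E)
    (ξ₀ : E) (hξ : ∀ n ∈ S, ‖ξ n - ξ₀‖ ≤ κ / 4) (x : E) :
    ‖∑ n ∈ S, a n * Complex.exp (2 * π * I * (⟪ξ n, x⟫ : ℂ))‖ ≤
      ∫ y, ‖∑ n ∈ S, a n * Complex.exp (2 * π * I * (⟪ξ n, x - y⟫ : ℂ))‖ *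
        |lowPassKernel E κ y| := by
  have hn1 : ∀ r : ℝ, ‖Complex.exp (2 * π * I * (r : ℂ))‖ = 1 := fun r => by
    rw [show (2 * π * I * (r : ℂ)) = ((2 * π * r : ℝ) : ℂ) * I by push_cast; ring]
    exact Complex.norm_exp_ofReal_mul_I _
  rw [expSum_eq_integral hκ S a ξ ξ₀ hξ x]
  refine (norm_integral_le_integral_norm _).trans (le_of_eq ?_)
  refine integral_congr_ae (Eventually.of_forall fun y => ?_)
  simp only
  rw [norm_mul, norm_mul, Complex.norm_real, Real.norm_eq_abs, hn1, mul_one]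

/-! ### Decay of the kernel -/

/-- **Schwartz decay of the dilated kernels**: for every `M` there is `C` with
`|g_κ(y)| ≤ C κ^d / (1 + κ‖y‖)^M` for all `κ > 0` and `y` (`g_κ(y) = κ^d g₁(κy)` and `g₁` is a
Schwartz function). [folklore] -/
theorem abs_lowPassKernel_le (M : ℕ) : ∃ C : ℝ, 0 ≤ C ∧ ∀ κ : ℝ, 0 < κ → ∀ y : E,
    |lowPassKernel E κ y| ≤ C * κ ^ Module.finrank ℝ E / (1 + κ * ‖y‖) ^ M := by
  set C : ℝ := 2 ^ M * ((Finset.Iic (M, 0)).sup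
    (fun m => SchwartzMap.seminorm ℝ m.1 m.2) (lowPassKernelC E)) with hC
  have hC0 : 0 ≤ C := by positivity
  refine ⟨C, hC0, fun κ hκ y => ?_⟩
  have hdec := SchwartzMap.one_add_le_sup_seminorm_apply (𝕜 := ℝ) (m := (M, 0)) (k := M) (n := 0)
    le_rfl le_rfl (lowPassKernelC E) (κ • y)
  rw [norm_iteratedFDeriv_zero] at hdec
  have hnorm : ‖(lowPassKernelC E) (κ • y)‖ = |lowPassKernelOne E (κ • y)| := by
    rw [← Real.norm_eq_abs, norm_lowPassKernelOne]
  rw [hnorm, norm_smul, Real.norm_of_nonneg hκ.le] at hdec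
  have hpos : 0 < (1 + κ * ‖y‖) ^ M := by positivity
  rw [lowPassKernel_apply, abs_mul, abs_pow, abs_of_pos hκ, le_div_iff₀ hpos]
  calc κ ^ Module.finrank ℝ E * |lowPassKernelOne E (κ • y)| * (1 + κ * ‖y‖) ^ M
      = κ ^ Module.finrank ℝ E * ((1 + κ * ‖y‖) ^ M * |lowPassKernelOne E (κ • y)|) := by ring
    _ ≤ κ ^ Module.finrank ℝ E * C := mul_le_mul_of_nonneg_left hdec (by positivity)
    _ = C * κ ^ Module.finrank ℝ E := by ring


/-! ### The `p`-th power form (Jensen) -/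

/-- **The locally constant inequality, `L^p` form.** With the hypotheses of `expSum_eq_integral`
and `p ≥ 1`: `|F(x)|^p ≤ m^{p-1} ∫ |F(x - y)|^p |g_κ(y)| dy`, `m = ∫ |g_κ| = lowPassMass E`
(Jensen's inequality for the probability measure `|g_κ| dy / m`). [folklore] -/
theorem norm_expSum_rpow_le_integral {κ : ℝ} (hκ : 0 < κ) (S : Finset ι) (a : ι → ℂ)
    (ξ : ι → E) (ξ₀ : E) (hξ : ∀ n ∈ S, ‖ξ n - ξ₀‖ ≤ κ / 4) {p : ℝ} (hp : 1 ≤ p) (x : E) :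
    ‖∑ n ∈ S, a n * Complex.exp (2 * π * I * (⟪ξ n, x⟫ : ℂ))‖ ^ p ≤
      lowPassMass E ^ (p - 1) *
        ∫ y, ‖∑ n ∈ S, a n * Complex.exp (2 * π * I * (⟪ξ n, x - y⟫ : ℂ))‖ ^ p *
          |lowPassKernel E κ y| := by
  have hp0 : 0 < p := by linarith
  obtain ⟨G, hG⟩ : ∃ G : E → ℝ, ∀ y,
      G y = ‖∑ n ∈ S, a n * Complex.exp (2 * π * I * (⟪ξ n, x - y⟫ : ℂ))‖ := ⟨_, fun _ => rfl⟩
  obtain ⟨h, hh⟩ : ∃ h : E → ℝ, ∀ y, h y = |lowPassKernel E κ y| := ⟨_, fun _ => rfl⟩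
  -- properties of `G`
  have hG0 : ∀ y, 0 ≤ G y := fun y => by rw [hG]; exact norm_nonneg _
  have hGle : ∀ y, G y ≤ ∑ n ∈ S, ‖a n‖ := by
    intro y
    rw [hG]
    refine (norm_sum_le _ _).trans (le_of_eq (Finset.sum_congr rfl fun n _ => ?_))
    rw [norm_mul, show (2 * π * I * (⟪ξ n, x - y⟫ : ℂ)) = ((2 * π * ⟪ξ n, x - y⟫ : ℝ) : ℂ) * I by
      push_cast; ring, Complex.norm_exp_ofReal_mul_I, mul_one]
  have hGcont : Continuous G := by
    have e : G = fun y => ‖∑ n ∈ S, a n * Complex.exp (2 * π * I * (⟪ξ n, x - y⟫ : ℂ))‖ :=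
      funext hG
    rw [e]
    fun_prop
  -- properties of `h`
  have hh0 : ∀ y, 0 ≤ h y := fun y => by rw [hh]; exact abs_nonneg _
  have hhcont : Continuous h := by
    have e : h = fun y => |lowPassKernel E κ y| := funext hh
    rw [e]
    exact (continuous_lowPassKernel κ).abs
  have hhint : Integrable h := by
    have e : h = fun y => |lowPassKernel E κ y| := funext hh
    rw [e]
    exact (integrable_lowPassKernel hκ).abs
  have hhm : ∫ y, h y = lowPassMass E := by
    have e : h = fun y => |lowPassKernel E κ y| := funext hh
    rw [e]
    exact integral_abs_lowPassKernel hκ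
  have hm1 : 1 ≤ lowPassMass E := one_le_lowPassMass
  have hm0 : 0 < lowPassMass E := by linarith
  -- Step 1: the pointwise inequality
  have h1 : ‖∑ n ∈ S, a n * Complex.exp (2 * π * I * (⟪ξ n, x⟫ : ℂ))‖ ≤ ∫ y, G y * h y := by
    have := norm_expSum_le_integral hκ S a ξ ξ₀ hξ x
    simp_rw [← hG, ← hh] at this
    exact this
  -- Step 2: Jensen for the probability measure `h dy / m`
  set μ : Measure E := volume.withDensity (fun y => ENNReal.ofReal (h y)) with hμ
  haveI hfin : IsFiniteMeasure μ := isFiniteMeasure_withDensity_ofReal hhint.hasFiniteIntegral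
  have hμuniv : μ Set.univ = ENNReal.ofReal (lowPassMass E) := by
    rw [hμ, withDensity_apply _ MeasurableSet.univ, Measure.restrict_univ,
      ← ofReal_integral_eq_lintegral_ofReal hhint (ae_of_all _ hh0), hhm]
  have hμ0 : μ ≠ 0 := by
    intro h0
    have h1' : μ Set.univ = 0 := by rw [h0]; rfl
    rw [hμuniv, ENNReal.ofReal_eq_zero] at h1'
    linarith
  have hint_eq : ∀ φ : E → ℝ, ∫ y, φ y ∂μ = ∫ y, h y * φ y := by
    intro φ
    have e : (fun y => ENNReal.ofReal (h y)) = fun y => (((h y).toNNReal : NNReal) : ENNReal) :=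
      rfl
    rw [hμ, e, integral_withDensity_eq_integral_smul hhcont.measurable.real_toNNReal φ]
    refine integral_congr_ae (Eventually.of_forall fun y => ?_)
    simp only [NNReal.smul_def, smul_eq_mul, Real.coe_toNNReal _ (hh0 y)]
  have hGint : Integrable G μ :=
    (integrable_const (∑ n ∈ S, ‖a n‖)).mono' hGcont.aestronglyMeasurable
      (ae_of_all _ fun y => by rw [Real.norm_of_nonneg (hG0 y)]; exact hGle y)
  have hGpint : Integrable (fun y => G y ^ p) μ :=
    (integrable_const ((∑ n ∈ S, ‖a n‖) ^ p)).mono'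
      ((hGcont.rpow_const fun y => Or.inr hp0.le).aestronglyMeasurable)
      (ae_of_all _ fun y => by
        rw [Real.norm_of_nonneg (Real.rpow_nonneg (hG0 y) _)]
        exact Real.rpow_le_rpow (hG0 y) (hGle y) hp0.le)
  haveI hne : NeZero μ := ⟨hμ0⟩
  have hJ := ConvexOn.map_average_le (μ := μ) (f := G) (convexOn_rpow hp)
    (Real.continuous_rpow_const hp0.le).continuousOn isClosed_Ici
    (ae_of_all _ fun y => (hG0 y : G y ∈ Set.Ici 0)) hGint hGpint
  -- unpack the averages
  rw [average_eq, average_eq, measureReal_def, hμuniv, ENNReal.toReal_ofReal hm0.le,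
    smul_eq_mul, smul_eq_mul, hint_eq, hint_eq] at hJ
  -- hJ : (m⁻¹ * ∫ h G) ^ p ≤ m⁻¹ * ∫ h G^p
  have hI0 : 0 ≤ ∫ y, h y * G y := integral_nonneg fun y => mul_nonneg (hh0 y) (hG0 y)
  have h2 : (∫ y, G y * h y) ^ p ≤ lowPassMass E ^ (p - 1) * ∫ y, h y * G y ^ p := by
    have e1 : (∫ y, G y * h y) = lowPassMass E * ((lowPassMass E)⁻¹ * ∫ y, h y * G y) := by
      rw [← mul_assoc, mul_inv_cancel₀ hm0.ne', one_mul]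
      exact integral_congr_ae (Eventually.of_forall fun y => mul_comm _ _)
    rw [e1, Real.mul_rpow hm0.le (by positivity)]
    calc lowPassMass E ^ p * ((lowPassMass E)⁻¹ * ∫ y, h y * G y) ^ p
        ≤ lowPassMass E ^ p * ((lowPassMass E)⁻¹ * ∫ y, h y * G y ^ p) :=
          mul_le_mul_of_nonneg_left hJ (Real.rpow_nonneg hm0.le _)
      _ = lowPassMass E ^ (p - 1) * ∫ y, h y * G y ^ p := by
          rw [Real.rpow_sub_one hm0.ne', ← mul_assoc, div_eq_mul_inv]
  -- Step 3: assemble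
  have h3 : ‖∑ n ∈ S, a n * Complex.exp (2 * π * I * (⟪ξ n, x⟫ : ℂ))‖ ^ p ≤
      (∫ y, G y * h y) ^ p := Real.rpow_le_rpow (norm_nonneg _) h1 hp0.le
  have e2 : (∫ y, ‖∑ n ∈ S, a n * Complex.exp (2 * π * I * (⟪ξ n, x - y⟫ : ℂ))‖ ^ p *
      |lowPassKernel E κ y|) = ∫ y, h y * G y ^ p := by
    refine integral_congr_ae (Eventually.of_forall fun y => ?_)
    simp only
    rw [hG, hh, mul_comm]
  rw [e2]
  exact h3.trans h2

/-! ### Explicit polynomial weights -/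

/-- **The locally constant inequality with the weight `(1 + κ‖y‖)^{-M}`**: for `M > dim E` there is
`C = C(M, E)` such that for every `κ > 0`, every exponential sum `F` with frequencies in a ball
`‖ξ - ξ₀‖ ≤ κ/4`, every `p ≥ 1` and every `x`,
`|F(x)|^p ≤ m^{p-1} C κ^d ∫ |F(x - y)|^p (1 + κ‖y‖)^{-M} dy` (`m = lowPassMass E`,
`d = dim E`). This is the form in which "`|F|` is essentially constant on balls of radius `1/κ`"
enters decoupling arguments (weights `w_B`). [folklore] -/
theorem norm_expSum_rpow_le_integral_weight {M : ℕ} (hM : Module.finrank ℝ E < M) :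
    ∃ C : ℝ, 0 ≤ C ∧ ∀ κ : ℝ, 0 < κ → ∀ (S : Finset ι) (a : ι → ℂ) (ξ : ι → E) (ξ₀ : E),
      (∀ n ∈ S, ‖ξ n - ξ₀‖ ≤ κ / 4) → ∀ p : ℝ, 1 ≤ p → ∀ x : E,
        ‖∑ n ∈ S, a n * Complex.exp (2 * π * I * (⟪ξ n, x⟫ : ℂ))‖ ^ p ≤
          lowPassMass E ^ (p - 1) * (C * κ ^ Module.finrank ℝ E) *
            ∫ y, ‖∑ n ∈ S, a n * Complex.exp (2 * π * I * (⟪ξ n, x - y⟫ : ℂ))‖ ^ p /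
              (1 + κ * ‖y‖) ^ M := by
  obtain ⟨C, hC0, hC⟩ := abs_lowPassKernel_le (E := E) M
  refine ⟨C, hC0, fun κ hκ S a ξ ξ₀ hξ p hp x => ?_⟩
  have hp0 : 0 < p := by linarith
  have hm1 : 1 ≤ lowPassMass E := one_le_lowPassMass
  have h1 := norm_expSum_rpow_le_integral hκ S a ξ ξ₀ hξ hp x
  refine h1.trans ?_
  rw [mul_assoc (lowPassMass E ^ (p - 1))]
  refine mul_le_mul_of_nonneg_left ?_ (Real.rpow_nonneg (zero_le_one.trans hm1) _)
  rw [← integral_const_mul]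
  -- compare the integrands; both are integrable
  obtain ⟨G, hG⟩ : ∃ G : E → ℝ, ∀ y,
      G y = ‖∑ n ∈ S, a n * Complex.exp (2 * π * I * (⟪ξ n, x - y⟫ : ℂ))‖ := ⟨_, fun _ => rfl⟩
  have hG0 : ∀ y, 0 ≤ G y := fun y => by rw [hG]; exact norm_nonneg _
  have hGle : ∀ y, G y ≤ ∑ n ∈ S, ‖a n‖ := by
    intro y
    rw [hG]
    refine (norm_sum_le _ _).trans (le_of_eq (Finset.sum_congr rfl fun n _ => ?_))
    rw [norm_mul, show (2 * π * I * (⟪ξ n, x - y⟫ : ℂ)) = ((2 * π * ⟪ξ n, x - y⟫ : ℝ) : ℂ) * I by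
      push_cast; ring, Complex.norm_exp_ofReal_mul_I, mul_one]
  have hGcont : Continuous G := by
    have e : G = fun y => ‖∑ n ∈ S, a n * Complex.exp (2 * π * I * (⟪ξ n, x - y⟫ : ℂ))‖ :=
      funext hG
    rw [e]
    fun_prop
  have hGp : ∀ y, G y ^ p ≤ (∑ n ∈ S, ‖a n‖) ^ p := fun y =>
    Real.rpow_le_rpow (hG0 y) (hGle y) hp0.le
  have hGpcont : Continuous fun y => G y ^ p := hGcont.rpow_const fun y => Or.inr hp0.le
  -- integrability of the weight
  have hwint : Integrable fun y : E => ((1 + κ * ‖y‖) ^ M)⁻¹ := by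
    have hr : (Module.finrank ℝ E : ℝ) < (M : ℝ) := by exact_mod_cast hM
    have h0 := (integrable_one_add_norm (E := E) (μ := volume) hr).comp_smul hκ.ne'
    refine h0.congr (Eventually.of_forall fun y => ?_)
    simp only
    rw [norm_smul, Real.norm_of_nonneg hκ.le, Real.rpow_neg (by positivity), Real.rpow_natCast]
  simp_rw [← hG]
  refine integral_mono ?_ ?_ fun y => ?_
  · -- `G^p |g_κ|` is integrable
    have : Integrable fun y => (∑ n ∈ S, ‖a n‖) ^ p * |lowPassKernel E κ y| :=
      ((integrable_lowPassKernel hκ).abs).const_mul _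
    refine this.mono' (hGpcont.mul (continuous_lowPassKernel κ).abs).aestronglyMeasurable
      (ae_of_all _ fun y => ?_)
    rw [Real.norm_of_nonneg (mul_nonneg (Real.rpow_nonneg (hG0 y) _) (abs_nonneg _))]
    exact mul_le_mul_of_nonneg_right (hGp y) (abs_nonneg _)
  · -- the weighted majorant is integrable
    have : Integrable fun y : E => C * κ ^ Module.finrank ℝ E *
        ((∑ n ∈ S, ‖a n‖) ^ p * ((1 + κ * ‖y‖) ^ M)⁻¹) := (hwint.const_mul _).const_mul _
    refine this.mono' ?_ (ae_of_all _ fun y => ?_)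
    · exact (continuous_const.mul (hGpcont.div (by fun_prop) fun y => by positivity)).aestronglyMeasurable
    · have hw0 : 0 < (1 + κ * ‖y‖) ^ M := by positivity
      have hCκ : 0 ≤ C * κ ^ Module.finrank ℝ E := by positivity
      have hGp0 : 0 ≤ G y ^ p := Real.rpow_nonneg (hG0 y) _
      rw [Real.norm_of_nonneg (mul_nonneg hCκ (div_nonneg hGp0 hw0.le)), div_eq_mul_inv]
      exact mul_le_mul_of_nonneg_left (mul_le_mul_of_nonneg_right (hGp y) (by positivity)) hCκ
  · -- pointwise comparison
    simp only
    have hw0 : 0 < (1 + κ * ‖y‖) ^ M := by positivity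
    have hk := hC κ hκ y
    calc G y ^ p * |lowPassKernel E κ y|
        ≤ G y ^ p * (C * κ ^ Module.finrank ℝ E / (1 + κ * ‖y‖) ^ M) :=
          mul_le_mul_of_nonneg_left hk (Real.rpow_nonneg (hG0 y) _)
      _ = C * κ ^ Module.finrank ℝ E * (G y ^ p / (1 + κ * ‖y‖) ^ M) := by ring


/-- **Locally constant on balls of radius `1/κ`.** For `M > dim E` there is `C` such that, with
`F`, `κ`, `p` as in `norm_expSum_rpow_le_integral_weight`, for all `x` and all `x'` with
`‖x' - x‖ ≤ 1/κ`: `|F(x')|^p ≤ m^{p-1} C κ^d ∫ |F(x - y)|^p (1 + κ‖y‖)^{-M} dy` — the same weighted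
average at `x` controls `sup_{B(x, 1/κ)} |F|^p` (translate and use Peetre's inequality
`1 + κ‖y‖ ≤ 2 (1 + κ‖y + h‖)` for `κ‖h‖ ≤ 1`). [folklore] -/
theorem norm_expSum_rpow_le_integral_weight_of_norm_sub_le {M : ℕ} (hM : Module.finrank ℝ E < M) :
    ∃ C : ℝ, 0 ≤ C ∧ ∀ κ : ℝ, 0 < κ → ∀ (S : Finset ι) (a : ι → ℂ) (ξ : ι → E) (ξ₀ : E),
      (∀ n ∈ S, ‖ξ n - ξ₀‖ ≤ κ / 4) → ∀ p : ℝ, 1 ≤ p → ∀ x x' : E, ‖x' - x‖ ≤ 1 / κ →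
        ‖∑ n ∈ S, a n * Complex.exp (2 * π * I * (⟪ξ n, x'⟫ : ℂ))‖ ^ p ≤
          lowPassMass E ^ (p - 1) * (C * κ ^ Module.finrank ℝ E) *
            ∫ y, ‖∑ n ∈ S, a n * Complex.exp (2 * π * I * (⟪ξ n, x - y⟫ : ℂ))‖ ^ p /
              (1 + κ * ‖y‖) ^ M := by
  obtain ⟨C, hC0, hC⟩ := norm_expSum_rpow_le_integral_weight (E := E) (ι := ι) hM
  refine ⟨2 ^ M * C, by positivity, fun κ hκ S a ξ ξ₀ hξ p hp x x' hx' => ?_⟩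
  have hp0 : 0 < p := by linarith
  have hm1 : 1 ≤ lowPassMass E := one_le_lowPassMass
  have h1 := hC κ hκ S a ξ ξ₀ hξ p hp x'
  refine h1.trans ?_
  -- translate the integral from `x'` to `x`
  set h : E := x' - x with hh
  obtain ⟨G, hG⟩ : ∃ G : E → ℝ, ∀ y,
      G y = ‖∑ n ∈ S, a n * Complex.exp (2 * π * I * (⟪ξ n, x - y⟫ : ℂ))‖ := ⟨_, fun _ => rfl⟩
  have hG0 : ∀ y, 0 ≤ G y := fun y => by rw [hG]; exact norm_nonneg _
  have hGle : ∀ y, G y ≤ ∑ n ∈ S, ‖a n‖ := by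
    intro y
    rw [hG]
    refine (norm_sum_le _ _).trans (le_of_eq (Finset.sum_congr rfl fun n _ => ?_))
    rw [norm_mul, show (2 * π * I * (⟪ξ n, x - y⟫ : ℂ)) = ((2 * π * ⟪ξ n, x - y⟫ : ℝ) : ℂ) * I by
      push_cast; ring, Complex.norm_exp_ofReal_mul_I, mul_one]
  have hGcont : Continuous G := by
    have e : G = fun y => ‖∑ n ∈ S, a n * Complex.exp (2 * π * I * (⟪ξ n, x - y⟫ : ℂ))‖ :=
      funext hG
    rw [e]
    fun_prop
  have hGp : ∀ y, G y ^ p ≤ (∑ n ∈ S, ‖a n‖) ^ p := fun y =>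
    Real.rpow_le_rpow (hG0 y) (hGle y) hp0.le
  have hGpcont : Continuous fun y => G y ^ p := hGcont.rpow_const fun y => Or.inr hp0.le
  have htrans : (∫ y, ‖∑ n ∈ S, a n * Complex.exp (2 * π * I * (⟪ξ n, x' - y⟫ : ℂ))‖ ^ p /
      (1 + κ * ‖y‖) ^ M) = ∫ y, G (y - h) ^ p / (1 + κ * ‖y‖) ^ M := by
    refine integral_congr_ae (Eventually.of_forall fun y => ?_)
    simp only
    rw [hG, hh]
    congr 3
    abel_nf
  have htrans' : (∫ y, G (y - h) ^ p / (1 + κ * ‖y‖) ^ M) =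
      ∫ y, G y ^ p / (1 + κ * ‖y + h‖) ^ M := by
    have := integral_sub_right_eq_self (μ := (volume : Measure E))
      (fun y => G y ^ p / (1 + κ * ‖y + h‖) ^ M) h
    simp only [sub_add_cancel] at this
    rw [← this]
  rw [htrans, htrans']
  -- integrability of the weight at `x`
  have hwint : Integrable fun y : E => ((1 + κ * ‖y‖) ^ M)⁻¹ := by
    have hr : (Module.finrank ℝ E : ℝ) < (M : ℝ) := by exact_mod_cast hM
    have h0 := (integrable_one_add_norm (E := E) (μ := volume) hr).comp_smul hκ.ne'
    refine h0.congr (Eventually.of_forall fun y => ?_)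
    simp only
    rw [norm_smul, Real.norm_of_nonneg hκ.le, Real.rpow_neg (by positivity), Real.rpow_natCast]
  -- Peetre: `(1 + κ‖y‖)^M ≤ 2^M (1 + κ‖y + h‖)^M`
  have hκh : κ * ‖h‖ ≤ 1 := by
    rw [hh]
    calc κ * ‖x' - x‖ ≤ κ * (1 / κ) := mul_le_mul_of_nonneg_left hx' hκ.le
      _ = 1 := by field_simp
  have hpeetre : ∀ y : E, (1 + κ * ‖y‖) ^ M ≤ 2 ^ M * (1 + κ * ‖y + h‖) ^ M := by
    intro y
    rw [← mul_pow]
    apply pow_le_pow_left₀ (by positivity)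
    have : ‖y‖ ≤ ‖y + h‖ + ‖h‖ := by
      calc ‖y‖ = ‖(y + h) - h‖ := by rw [add_sub_cancel_right]
        _ ≤ ‖y + h‖ + ‖h‖ := norm_sub_le _ _
    nlinarith [mul_le_mul_of_nonneg_left this hκ.le, norm_nonneg (y + h), hκ.le]
  -- compare the integrals
  have hint1 : Integrable fun y => G y ^ p / (1 + κ * ‖y + h‖) ^ M := by
    have hw' : Integrable fun y : E => ((1 + κ * ‖y + h‖) ^ M)⁻¹ := hwint.comp_add_right h
    have : Integrable fun y : E => (∑ n ∈ S, ‖a n‖) ^ p * ((1 + κ * ‖y + h‖) ^ M)⁻¹ :=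
      hw'.const_mul _
    refine this.mono' ?_ (ae_of_all _ fun y => ?_)
    · exact (hGpcont.div (by fun_prop) fun y => by positivity).aestronglyMeasurable
    · have hw0 : 0 < (1 + κ * ‖y + h‖) ^ M := by positivity
      rw [Real.norm_of_nonneg (div_nonneg (Real.rpow_nonneg (hG0 y) _) hw0.le), div_eq_mul_inv]
      exact mul_le_mul_of_nonneg_right (hGp y) (by positivity)
  have hint2 : Integrable fun y => 2 ^ M * (G y ^ p / (1 + κ * ‖y‖) ^ M) := by
    have : Integrable fun y : E => 2 ^ M * ((∑ n ∈ S, ‖a n‖) ^ p * ((1 + κ * ‖y‖) ^ M)⁻¹) :=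
      (hwint.const_mul _).const_mul _
    refine this.mono' ?_ (ae_of_all _ fun y => ?_)
    · exact (continuous_const.mul (hGpcont.div (by fun_prop) fun y => by positivity)).aestronglyMeasurable
    · have hw0 : 0 < (1 + κ * ‖y‖) ^ M := by positivity
      have h2M : (0 : ℝ) ≤ 2 ^ M := by positivity
      rw [Real.norm_of_nonneg (mul_nonneg h2M (div_nonneg (Real.rpow_nonneg (hG0 y) _) hw0.le)),
        div_eq_mul_inv]
      exact mul_le_mul_of_nonneg_left (mul_le_mul_of_nonneg_right (hGp y) (by positivity)) h2M
  have hI : (∫ y, G y ^ p / (1 + κ * ‖y + h‖) ^ M) ≤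
      ∫ y, 2 ^ M * (G y ^ p / (1 + κ * ‖y‖) ^ M) := by
    refine integral_mono hint1 hint2 fun y => ?_
    simp only
    have hw0 : 0 < (1 + κ * ‖y‖) ^ M := by positivity
    have hw1 : 0 < (1 + κ * ‖y + h‖) ^ M := by positivity
    have hGp0 : 0 ≤ G y ^ p := Real.rpow_nonneg (hG0 y) _
    rw [div_le_iff₀ hw1, mul_div_assoc', div_mul_eq_mul_div, le_div_iff₀ hw0]
    calc G y ^ p * (1 + κ * ‖y‖) ^ M ≤ G y ^ p * (2 ^ M * (1 + κ * ‖y + h‖) ^ M) :=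
          mul_le_mul_of_nonneg_left (hpeetre y) hGp0
      _ = 2 ^ M * G y ^ p * (1 + κ * ‖y + h‖) ^ M := by ring
  rw [integral_const_mul] at hI
  simp_rw [← hG]
  calc lowPassMass E ^ (p - 1) * (C * κ ^ Module.finrank ℝ E) *
        ∫ y, G y ^ p / (1 + κ * ‖y + h‖) ^ M
      ≤ lowPassMass E ^ (p - 1) * (C * κ ^ Module.finrank ℝ E) *
          (2 ^ M * ∫ y, G y ^ p / (1 + κ * ‖y‖) ^ M) := by
        apply mul_le_mul_of_nonneg_left hI
        exact mul_nonneg (Real.rpow_nonneg (zero_le_one.trans hm1) _) (by positivity)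
    _ = lowPassMass E ^ (p - 1) * (2 ^ M * C * κ ^ Module.finrank ℝ E) *
          ∫ y, G y ^ p / (1 + κ * ‖y‖) ^ M := by ring

end ExpSumLocallyConstant
end Literature.Analysis.Fourier
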